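import Summits.QuantumAdvantage.QuantumAdvantage.Theorems.WhiteBoxWalkDefs

/-!
# Route `WhiteBoxWalk`, crux `WbwThesis` (stmt-QuantumAdvantage-2238), line `Sketch`: the canonical preimage

`stub_canon`: `prePQ w` is a `genPQ`-preimage of `genPQ w` of length `|w|`, and `|w| ≤ |genPQ w|`.
Three lemmas (sub-namespace `Canon`):

* `Canon.yaoPre_spec` (GENERIC, any `Yao.Params P`): if `c |x| (f x)` is an `f`-preimage of `f x` of
  length `|x|` for every `x`, then the blockwise map `yaoPre P c` is a length-preserving
  `g`-preimage map.  With `n = nOf |w|`, `t = t(n)`: `n · t ≤ |w|` (`Yao.M_nOf_le`), so the `t`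
  leading `n`-blocks of `w` are full (`Yao.length_blk_of_le`), every replacement block has length
  `n`, hence `|yaoPre P c w| = |w|`, the blocks of `yaoPre P c w` are the replacement blocks
  (`blk_flatten_append`), the padded `f`-images agree, and the suffix is untouched.
* `Canon.fPQ_invPQ` (SPECIFIC): `invPQ |x| (fPQ x)` is an `fPQ`-preimage of `fPQ x` of length `|x|`.
  On the hard branch the body of `fPQ x` is the width-`|x|` numeral of `N = P · Q` for two `m`-bit
  primes (`m = ⌊|x|/2⌋`, so `N < 2^{2m} ≤ 2^{|x|}` and the numeral is exact), `minFac N ∈ {P, Q}`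
  and `N / minFac N` is the other prime; re-encoding two `m`-bit primes on the two halves of a
  length-`|x|` block gives a hard-branch block with the same product (`fPQ_halves`).
* `Canon.length_le_length_genPQ`: `|genPQ w| = t · (2n + 6) + 2(|w| - n t) + 2 ≥ |w|` (`Yao.length_g`
  with `p = X + 1`).
-/

noncomputable section

set_option linter.dupNamespace false -- D-0017: single-problem summit ⇒ `QuantumAdvantage.QuantumAdvantage` by design

namespace Summit.QuantumAdvantage.QuantumAdvantage.Theorems.WhiteBoxWalk

open Literature.Computability.Cryptography Literature.Computability.Complexity
open _root_.Computability Polynomial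

namespace Canon

/-! ### Blocks of a concatenation of equal-length pieces -/

/-- A concatenation of `|L|` pieces of length `n` has length `|L| · n`. [folklore] -/
theorem length_flatten_of_forall {n : ℕ} :
    ∀ L : List (List Bool), (∀ a ∈ L, a.length = n) → L.flatten.length = L.length * n
  | [], _ => by simp
  | a :: L, hL => by
    rw [List.flatten_cons, List.length_append, hL a (List.mem_cons_self ..),
      length_flatten_of_forall L fun b hb => hL b (List.mem_cons_of_mem a hb), List.length_cons]
    ring

/-- The `j`-th length-`n` block of `L.flatten ++ tail`, for pieces of length exactly `n`, is the
`j`-th piece. [folklore] -/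
theorem blk_flatten_append {n : ℕ} :
    ∀ (L : List (List Bool)) (tail : List Bool) (j : ℕ) (hj : j < L.length),
      (∀ a ∈ L, a.length = n) → Yao.blk n j (L.flatten ++ tail) = L[j]
  | [], _, _, hj, _ => absurd hj (Nat.not_lt_zero _)
  | a :: L, tail, 0, _, hL => by
    rw [Yao.blk_eq_take_drop, Nat.zero_mul, List.drop_zero, List.flatten_cons, List.append_assoc,
      List.take_left' (hL a (List.mem_cons_self ..)), List.getElem_cons_zero]
  | a :: L, tail, j + 1, hj, hL => by
    have ha : a.length = n := hL a (List.mem_cons_self ..)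
    have ih := blk_flatten_append L tail j (by simpa using hj) fun b hb => hL b (List.mem_cons_of_mem a hb)
    have hd : List.drop ((j + 1) * n) (a ++ (L.flatten ++ tail)) = List.drop (j * n) (L.flatten ++ tail) := by
      rw [Nat.add_mul, Nat.one_mul, List.drop_append, List.drop_eq_nil_of_le (by rw [ha]; omega),
        List.nil_append, ha, Nat.add_sub_cancel]
    rw [Yao.blk_eq_take_drop] at ih ⊢
    rw [List.flatten_cons, List.append_assoc, hd, ih, List.getElem_cons_succ]

/-! ### Blockwise canonical preimages of a Yao product -/

/-- **Blockwise canonical preimages of a Yao product.** If `c |x| (f x)` is an `f`-preimage of `f x`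
of length `|x|` for every `x`, then `yaoPre P c w` is a `g`-preimage of `g w` of length `|w|`.
[folklore] -/
theorem yaoPre_spec (P : Yao.Params) (c : ℕ → List Bool → List Bool)
    (hc : ∀ x, P.f (c x.length (P.f x)) = P.f x) (hcl : ∀ x, (c x.length (P.f x)).length = x.length)
    (w : List Bool) : P.g (yaoPre P c w) = P.g w ∧ (yaoPre P c w).length = w.length := by
  obtain ⟨n, hn⟩ : ∃ n, P.nOf w.length = n := ⟨_, rfl⟩
  obtain ⟨t, ht⟩ : ∃ t, P.T n = t := ⟨_, rfl⟩
  have hM : n * t ≤ w.length := by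
    have h := Yao.M_nOf_le P w.length
    rw [Yao.Params.M, hn, ht] at h
    exact h
  have hM' : t * n ≤ w.length := by rw [Nat.mul_comm]; exact hM
  have hblk : ∀ j, j < t → (Yao.blk n j w).length = n := fun j hj =>
    Yao.length_blk_of_le ((Nat.mul_le_mul_right n hj).trans hM')
  -- the replacement blocks
  obtain ⟨L, hL⟩ : ∃ L, (List.range t).map (fun j => c n (P.f (Yao.blk n j w))) = L := ⟨_, rfl⟩
  have hLlen : L.length = t := by rw [← hL, List.length_map, List.length_range]
  have hLn : ∀ a ∈ L, a.length = n := by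
    intro a ha
    rw [← hL, List.mem_map] at ha
    obtain ⟨j, hj, rfl⟩ := ha
    rw [List.mem_range] at hj
    have h := hcl (Yao.blk n j w)
    rwa [hblk j hj] at h
  have hLj : ∀ (j : ℕ) (hj : j < L.length), L[j] = c n (P.f (Yao.blk n j w)) := by
    subst hL
    intro j hj
    rw [List.getElem_map, List.getElem_range]
  have hpre : yaoPre P c w = L.flatten ++ w.drop (n * t) := by
    rw [yaoPre, hn, ht, List.flatMap_def, hL]
  have hflat : L.flatten.length = n * t := by
    rw [length_flatten_of_forall L hLn, hLlen, Nat.mul_comm]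
  have hlen : (yaoPre P c w).length = w.length := by
    rw [hpre, List.length_append, hflat, List.length_drop]
    omega
  refine ⟨?_, hlen⟩
  have hcomps : P.comps n t (yaoPre P c w) = P.comps n t w := by
    unfold Yao.Params.comps
    refine List.map_congr_left fun j hj => ?_
    rw [List.mem_range] at hj
    show P.pad n (P.f (Yao.blk n j (yaoPre P c w))) = P.pad n (P.f (Yao.blk n j w))
    rw [hpre, blk_flatten_append L _ j (by rw [hLlen]; exact hj) hLn, hLj]
    have h := hc (Yao.blk n j w)
    rw [hblk j hj] at h
    rw [h]
  have hdrop : (yaoPre P c w).drop (n * t) = w.drop (n * t) := by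
    rw [hpre, List.drop_left' hflat]
  unfold Yao.Params.g
  rw [hlen, hn, ht, hcomps, hdrop]

/-! ### The canonical `fPQ`-preimage -/

/-- The width-`m` numeral is exact below `2^m`: `bitsToNat (encW m v) = v` (as `|encodeNat v| =
size v ≤ m`, cf. `length_encodeNat_le_of_lt` in `ShorClassicalOracle.lean`). [folklore] -/
theorem bitsToNat_encW {m v : ℕ} (h : v < 2 ^ m) : bitsToNat (encW m v) = v := by
  have hl : (encodeNat v).length ≤ m := by
    rw [← norm_encodeNat, length_norm, bitsToNat_encodeNat]
    exact Nat.size_le.2 h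
  rw [encW, List.take_of_length_le hl, bitsToNat_append, bitsToNat_replicate_false, Nat.mul_zero,
    Nat.add_zero, bitsToNat_encodeNat]

/-- Re-encoding two `m`-bit primes `a`, `b` (`m = ⌊n/2⌋`) on the two halves of a length-`n` block
gives a hard-branch block of length `n` with `fPQ`-image `1 · encW n (a · b)`. [folklore] -/
theorem fPQ_halves {n a b : ℕ} (ha : a.Prime) (hb : b.Prime) (ha1 : 2 ^ (n / 2 - 1) ≤ a)
    (hb1 : 2 ^ (n / 2 - 1) ≤ b) (ha2 : a < 2 ^ (n / 2)) (hb2 : b < 2 ^ (n / 2)) :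
    fPQ (encW (n / 2) a ++ encW (n / 2) b ++ List.replicate (n - 2 * (n / 2)) false) =
        true :: encW n (a * b) ∧
      (encW (n / 2) a ++ encW (n / 2) b ++ List.replicate (n - 2 * (n / 2)) false).length = n := by
  have hlen : (encW (n / 2) a ++ encW (n / 2) b ++ List.replicate (n - 2 * (n / 2)) false).length = n := by
    simp only [List.length_append, length_encW, List.length_replicate]
    omega
  have hp : pOf (encW (n / 2) a ++ encW (n / 2) b ++ List.replicate (n - 2 * (n / 2)) false) = a := by
    rw [pOf, hlen, List.append_assoc, List.take_left' (length_encW _ _)]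
    exact bitsToNat_encW ha2
  have hq : qOf (encW (n / 2) a ++ encW (n / 2) b ++ List.replicate (n - 2 * (n / 2)) false) = b := by
    rw [qOf, hlen, List.append_assoc, List.drop_left' (length_encW _ _), List.take_left' (length_encW _ _)]
    exact bitsToNat_encW hb2
  have hpp : isPrimePair (encW (n / 2) a ++ encW (n / 2) b ++ List.replicate (n - 2 * (n / 2)) false) = true := by
    rw [isPrimePair_eq_true_iff, hp, hq, hlen]
    exact ⟨ha, hb, ha1, hb1⟩
  refine ⟨?_, hlen⟩
  rw [fPQ, if_pos hpp, hlen, hp, hq]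

/-- **`invPQ` computes `fPQ`-preimages**: `invPQ |x| (fPQ x)` is an `fPQ`-preimage of `fPQ x` of
length `|x|` (easy branch: `x` itself; hard branch: split `P · Q` at its least prime factor).
[folklore] -/
theorem fPQ_invPQ (x : List Bool) :
    fPQ (invPQ x.length (fPQ x)) = fPQ x ∧ (invPQ x.length (fPQ x)).length = x.length := by
  by_cases hx : isPrimePair x = true
  · obtain ⟨hP, hQ, hP1, hQ1⟩ := (isPrimePair_eq_true_iff x).1 hx
    have hm : x.length / 2 ≤ x.length := Nat.div_le_self _ _
    have hP2 : pOf x < 2 ^ (x.length / 2) := by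
      have h := bitsToNat_lt (x.take (x.length / 2))
      rwa [List.length_take, Nat.min_eq_left hm] at h
    have hQ2 : qOf x < 2 ^ (x.length / 2) := by
      have h := bitsToNat_lt ((x.drop (x.length / 2)).take (x.length / 2))
      rwa [List.length_take, List.length_drop, Nat.min_eq_left (by omega)] at h
    have hlt : pOf x * qOf x < 2 ^ x.length :=
      calc pOf x * qOf x < 2 ^ (x.length / 2) * 2 ^ (x.length / 2) := Nat.mul_lt_mul'' hP2 hQ2
        _ ≤ 2 ^ x.length := by
          rw [← Nat.pow_add]
          exact Nat.pow_le_pow_right (by norm_num) (by omega)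
    have hfx : fPQ x = true :: encW x.length (pOf x * qOf x) := by rw [fPQ, if_pos hx]
    have h1 : pOf x * qOf x ≠ 1 := fun h => hP.ne_one (Nat.eq_one_of_mul_eq_one_right h)
    have hmf : (pOf x * qOf x).minFac.Prime := Nat.minFac_prime h1
    rw [hfx, invPQ, bitsToNat_encW hlt]
    rcases hmf.dvd_mul.1 (Nat.minFac_dvd _) with h | h
    · rw [(Nat.prime_dvd_prime_iff_eq hmf hP).1 h, Nat.mul_div_cancel_left _ hP.pos]
      exact fPQ_halves hP hQ hP1 hQ1 hP2 hQ2
    · rw [(Nat.prime_dvd_prime_iff_eq hmf hQ).1 h, Nat.mul_div_cancel _ hQ.pos, Nat.mul_comm (pOf x) (qOf x)]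
      exact fPQ_halves hQ hP hQ1 hP1 hQ2 hP2
  · have hfx : fPQ x = false :: x := by rw [fPQ, if_neg hx]
    rw [hfx]
    exact ⟨hfx, rfl⟩

/-! ### The instance is at least as long as the seed -/

/-- `|w| ≤ |genPQ w|`: `|genPQ w| = t · (2n + 6) + 2(|w| - n t) + 2` (`Yao.length_g`, `p = X + 1`)
and `n t ≤ |w|`. [folklore] -/
theorem length_le_length_genPQ (w : List Bool) : w.length ≤ (genPQ w).length := by
  rw [genPQ_eq, Yao.length_g pqParams_lenBound w]
  have hM : pqParams.nOf w.length * pqParams.T (pqParams.nOf w.length) ≤ w.length :=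
    Yao.M_nOf_le pqParams w.length
  have hcw : pqParams.cw (pqParams.nOf w.length) = 2 * pqParams.nOf w.length + 6 := by
    simp only [Yao.Params.cw, pqParams_p, eval_add, eval_X, eval_one]
    ring
  rw [hcw]
  obtain ⟨k, hk⟩ : ∃ k, pqParams.nOf w.length = k := ⟨_, rfl⟩
  rw [hk] at hM ⊢
  obtain ⟨t, ht⟩ : ∃ t, pqParams.T k = t := ⟨_, rfl⟩
  rw [ht] at hM ⊢
  have h3 : t * (2 * k + 6) = 2 * (k * t) + 6 * t := by ring
  omega

end Canon

/-- **Canonical preimage of the Yao product** (line `Sketch`, stub `stub_canon`). `prePQ w` is a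
`genPQ`-preimage of `genPQ w` of length `|w|`, and `|w| ≤ |genPQ w|`: blockwise, `invPQ n (fPQ x)` is
an `fPQ`-preimage of `fPQ x` of length `n = |x|` (`Canon.fPQ_invPQ`), the blocks of `yaoPre` realign
because they all have length `n` (`Canon.yaoPre_spec`), and `|g w| = t · cw + 2(|w| - n t) + 2 ≥ |w|`
(`Canon.length_le_length_genPQ`). -/
theorem stub_canon (w : List Bool) :
    genPQ (prePQ w) = genPQ w ∧ (prePQ w).length = w.length ∧ w.length ≤ (genPQ w).length := by
  obtain ⟨h1, h2⟩ := Canon.yaoPre_spec pqParams invPQ (fun x => (Canon.fPQ_invPQ x).1)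
    (fun x => (Canon.fPQ_invPQ x).2) w
  exact ⟨h1, h2, Canon.length_le_length_genPQ w⟩

end Summit.QuantumAdvantage.QuantumAdvantage.Theorems.WhiteBoxWalk

end
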